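import Summits.CriticalPhenomena.PercolationContinuityZ3.Theorems.Transplant.KNParaChainRun
import Summits.CriticalPhenomena.PercolationContinuityZ3.Theorems.Transplant.SkelPhiPgram
import Summits.CriticalPhenomena.PercolationContinuityZ3.Theorems.Transplant.SkelPhiEquilibriumDefs
import HarnessLib

/-!
# N1 (the `{±1}` node), LEVEL 1: the two 1-LIPSCHITZ RUN FRAMES of a Martineau–Tassion stride family — `runX φ c₀ n h σ = (σα, ⌊σβ′/(n+|h|)⌋)`
# (u-strides) and `runY φ c₀ n h σ = (⌊σβ′/(n+|h|)⌋, σα)` (v-strides), relative to a run origin `c₀` — so that `Skelφ.planarWindowWin` / `Win` apply to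
# RUN WINDOWS; the WINDOW-UNIT run parameters `xPrmW/yPrmW : ChainPara.RunPrm` (isotropic siting slack `R′`); and the BRIDGES from (S-1)'s pieces:
# `pgramPrism ⊆` link box, `pgSideHalf ⊆` x-landing slab/piece, `pgTopPiece ⊆` y′-landing slab/piece, in run coordinates

builds on p205010 (kernel theorem, internal audit signed; external expert review pending) — nothing in this file uses p205010; nothing here is a
claim about the open node `SamePDropOfSkeletonNeg`.
Lane `prim-bschramm`, seat `prim-bschramm-p1` (gen 11; NEG-SCOPE v1.1 §5 / P5-R2; lane INBOX 2026-08-21 ≈12:05Z: x-runs Markov-exact in `(α, β′)`, the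
transverse `β′` floored by its Lipschitz constant `n + |h|` so that the frame is sup-norm 1-Lipschitz; y′-runs with the coordinates exchanged); helper file
(`--supports stmt-CriticalPhenomena-4575 --as helper`).  Cells stay in hp-8's coarse skeleton `coarseSkel` (D1); these frames carry the RUN records only.
* §1 floor-division differences: `le_ediv_sub_ediv`, `ediv_sub_ediv_le_add_one`, `abs_ediv_sub_ediv_le` (the `≤ 1` case is hp-8's `TwoAxis.Para.abs_coarse_sub_le_one`);
* §2 `shearUnit n h = n + |h|`, **`runX`**, **`runY`**, evaluation lemmas, **`lip_runX`**, **`lip_runY`** (`Skelφ.Lip` from `Lip G φ`, `1 ≤ n`);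
* §3 relative coordinates in the frames: `runX_sub_runX_zero/one`, `runY_sub_runY_zero/one` (differences `w` vs `t` through `relCoord φ t`, `shearCoord φ t`);
* §4 window-unit run parameters **`xPrmW n ℓ h R′ q N`**, **`yPrmW n ℓ h v R′ q N`**, `xPrmW_ok`, `yPrmW_ok`, `xPrmW_eb`, `yPrmW_eb` (`eb = ea = R′`);
* §5 bridges (seed centre `t`, contact `w`): **`link_runX`** / **`link_runY`** (`w ∈ pgramPrism t n h (3ℓ) R` ⇒ link-box offsets `La`, `Lb`), **`landing_runX`** (`w ∈ pgSideHalf … σ τ` ⇒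
  along offset `= n`, signed transverse offset in the piece of sign `στ`), **`landing_runY`** (`w ∈ pgTopPiece … σ τ v` ⇒ along offset in `[sLo, sHi]`, transverse offset
  `− v` in the piece of sign `τ`).
[cite: MartineauTassion2017, §3.2 (pieces of [a,b,−a,−b]), §4.1, §4.3 Lemma 4.2 (arXiv:1312.1946 pp. 9–14)] [cite: KozmaNitzan2024, §4 Lemma 11 (pp. 22–23)]
-/

noncomputable section

namespace Summit.CriticalPhenomena.PercolationContinuityZ3.Theorems.Transplant

namespace Skelφ

open Literature.Probability.Percolation Literature.Probability.LatticeModels SimpleGraph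

variable {V : Type}

/-! ## §1 Floor-division differences -/

/-- `a ≤ x − y ⇒ ⌊a/D⌋ ≤ ⌊x/D⌋ − ⌊y/D⌋` (`D > 0`). [folklore] -/
theorem le_ediv_sub_ediv {D a x y : ℤ} (hD : 0 < D) (h : a ≤ x - y) : a / D ≤ x / D - y / D := by
  have h1 : y / D + a / D ≤ (y + a) / D := Int.ediv_add_ediv_le_add_ediv hD
  have h2 : (y + a) / D ≤ x / D := Int.ediv_le_ediv hD (by linarith)
  linarith

/-- `x − y ≤ b`, `0 ≤ b` ⇒ `⌊x/D⌋ − ⌊y/D⌋ ≤ ⌊b/D⌋ + 1` (`D > 0`). [folklore] -/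
theorem ediv_sub_ediv_le_add_one {D b x y : ℤ} (hD : 0 < D) (h : x - y ≤ b) : x / D - y / D ≤ b / D + 1 := by
  have hD0 : D ≠ 0 := hD.ne'
  have hy := Int.mul_ediv_add_emod y D
  have hb := Int.mul_ediv_add_emod b D
  have hry0 := Int.emod_nonneg y hD0; have hry1 := Int.emod_lt_of_pos y hD
  have hrb0 := Int.emod_nonneg b hD0; have hrb1 := Int.emod_lt_of_pos b hD
  have h1 : x / D ≤ (y + b) / D := Int.ediv_le_ediv hD (by linarith)
  have h2 : (y + b) / D = (y % D + b % D) / D + (y / D + b / D) := by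
    have : y + b = (y % D + b % D) + (y / D + b / D) * D := by linarith
    rw [this, Int.add_mul_ediv_right _ _ hD0]
  have h3 : (y % D + b % D) / D ≤ 1 := by
    have h4 : (y % D + b % D) / D ≤ (D - 1 + 1 * D) / D := Int.ediv_le_ediv hD (by linarith)
    have h5 : (D - 1) / D = 0 := Int.ediv_eq_zero_of_lt (by linarith) (by linarith)
    rw [Int.add_mul_ediv_right _ _ hD0, h5] at h4
    linarith
  linarith

/-- `|x − y| ≤ L` ⇒ `|⌊x/D⌋ − ⌊y/D⌋| ≤ ⌊L/D⌋ + 1` (`D > 0`). [folklore] -/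
theorem abs_ediv_sub_ediv_le {D L x y : ℤ} (hD : 0 < D) (h : |x - y| ≤ L) : |x / D - y / D| ≤ L / D + 1 := by
  rw [abs_le] at h ⊢
  have h1 := ediv_sub_ediv_le_add_one hD h.2
  have h2 := ediv_sub_ediv_le_add_one hD (show y - x ≤ L by linarith)
  constructor <;> linarith

/-! ## §2 The run frames and their Lipschitz property -/

/-- **The transverse floor unit** `n + |h|` (the Lipschitz constant of `β′` along an edge). [this work] -/
def shearUnit (n : ℕ) (h : ℤ) : ℕ := n + h.natAbs

/-- `1 ≤ n + |h|` when `1 ≤ n`. [folklore] -/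
theorem shearUnit_pos {n : ℕ} (hn : 1 ≤ n) (h : ℤ) : 0 < (shearUnit n h : ℤ) := by
  unfold shearUnit; push_cast; positivity

/-- **The x-run frame** `runX φ c₀ n h σ w = (σ·α(w), ⌊σ·β′(w)/(n+|h|)⌋)` relative to the run origin `c₀` (`α = relCoord φ c₀ 0`, `β′ = shearCoord φ c₀ n h`).
[this work] -/
def runX (φ : V → Site 2) (c₀ : V) (n : ℕ) (h σ : ℤ) : V → Site 2 :=
  fun w => ![σ * relCoord φ c₀ 0 w, (σ * shearCoord φ c₀ n h w) / (shearUnit n h : ℤ)]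

/-- **The y′-run frame** `runY φ c₀ n h σ w = (⌊σ·β′(w)/(n+|h|)⌋, σ·α(w))` (coordinates of `runX` exchanged: along = sheared height). [this work] -/
def runY (φ : V → Site 2) (c₀ : V) (n : ℕ) (h σ : ℤ) : V → Site 2 :=
  fun w => ![(σ * shearCoord φ c₀ n h w) / (shearUnit n h : ℤ), σ * relCoord φ c₀ 0 w]

/-- `runX`, first coordinate. [folklore] -/
@[simp] theorem runX_zero (φ : V → Site 2) (c₀ : V) (n : ℕ) (h σ : ℤ) (w : V) : runX φ c₀ n h σ w 0 = σ * relCoord φ c₀ 0 w := rfl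

/-- `runX`, second coordinate. [folklore] -/
@[simp] theorem runX_one (φ : V → Site 2) (c₀ : V) (n : ℕ) (h σ : ℤ) (w : V) :
    runX φ c₀ n h σ w 1 = (σ * shearCoord φ c₀ n h w) / (shearUnit n h : ℤ) := rfl

/-- `runY`, first coordinate. [folklore] -/
@[simp] theorem runY_zero (φ : V → Site 2) (c₀ : V) (n : ℕ) (h σ : ℤ) (w : V) :
    runY φ c₀ n h σ w 0 = (σ * shearCoord φ c₀ n h w) / (shearUnit n h : ℤ) := rfl

/-- `runY`, second coordinate. [folklore] -/
@[simp] theorem runY_one (φ : V → Site 2) (c₀ : V) (n : ℕ) (h σ : ℤ) (w : V) : runY φ c₀ n h σ w 1 = σ * relCoord φ c₀ 0 w := rfl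

variable {G : SimpleGraph V} {φ : V → Site 2}

/-- One edge moves `σ·α` by at most `1` and `⌊σ·β′/(n+|h|)⌋` by at most `1` (`σ = ±1`, `1 ≤ n`). [folklore] -/
theorem run_coords_sub_le_of_adj (hlip : Lip G φ) {σ : ℤ} (hσ : σ = 1 ∨ σ = -1) {n : ℕ} (hn : 1 ≤ n) (c₀ : V) (h : ℤ) {u w : V} (huw : G.Adj u w) :
    |σ * relCoord φ c₀ 0 u - σ * relCoord φ c₀ 0 w| ≤ 1 ∧
      |(σ * shearCoord φ c₀ n h u) / (shearUnit n h : ℤ) - (σ * shearCoord φ c₀ n h w) / (shearUnit n h : ℤ)| ≤ 1 := by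
  obtain ⟨h0, h1⟩ := shearCoord_sub_le_of_adj hlip huw c₀ n h
  have hσ1 : |σ| = 1 := by rcases hσ with rfl | rfl <;> simp
  refine ⟨?_, ?_⟩
  · rw [← mul_sub, abs_mul, hσ1, one_mul]; exact h0
  · -- hp-8's `abs_coarse_sub_le_one` with `c = 1`, `s = 0`, `D = L = n + |h|`
    have h2 : |σ * shearCoord φ c₀ n h u - σ * shearCoord φ c₀ n h w| ≤ (shearUnit n h : ℤ) := by
      rw [← mul_sub, abs_mul, hσ1, one_mul]
      unfold shearUnit; push_cast [Int.natCast_natAbs]; exact h1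
    have h3 := TwoAxis.Para.abs_coarse_sub_le_one (c := 1) (s := 0) (D := (shearUnit n h : ℤ)) (L := (shearUnit n h : ℤ))
      (t := σ * shearCoord φ c₀ n h u) (t' := σ * shearCoord φ c₀ n h w) zero_le_one (shearUnit_pos hn h) (by linarith) h2
    simpa [TwoAxis.Para.coarse] using h3

/-- **The x-run frame is sup-norm 1-Lipschitz** (so `planarWindowWin (lip_runX …)` is a planar window). [folklore] -/
theorem lip_runX (hlip : Lip G φ) {σ : ℤ} (hσ : σ = 1 ∨ σ = -1) {n : ℕ} (hn : 1 ≤ n) (c₀ : V) (h : ℤ) : Lip G (runX φ c₀ n h σ) := by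
  intro u w huw i
  obtain ⟨h0, h1⟩ := run_coords_sub_le_of_adj hlip hσ hn c₀ h huw
  fin_cases i
  · simpa [runX] using h0
  · simpa [runX] using h1

/-- **The y′-run frame is sup-norm 1-Lipschitz.** [folklore] -/
theorem lip_runY (hlip : Lip G φ) {σ : ℤ} (hσ : σ = 1 ∨ σ = -1) {n : ℕ} (hn : 1 ≤ n) (c₀ : V) (h : ℤ) : Lip G (runY φ c₀ n h σ) := by
  intro u w huw i
  obtain ⟨h0, h1⟩ := run_coords_sub_le_of_adj hlip hσ hn c₀ h huw
  fin_cases i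
  · simpa [runY] using h1
  · simpa [runY] using h0

/-! ## §3 Relative coordinates of a contact `w` seen from a seed centre `t` -/

/-- `relCoord` relative to `t` is the difference of `relCoord` relative to the run origin. [folklore] -/
theorem relCoord_sub_origin (φ : V → Site 2) (c₀ t : V) (i : Fin 2) (w : V) : relCoord φ t i w = relCoord φ c₀ i w - relCoord φ c₀ i t := by
  simp only [relCoord_apply]; ring

/-- `shearCoord` relative to `t` is the difference of `shearCoord` relative to the run origin (linearity). [folklore] -/
theorem shearCoord_sub_origin (φ : V → Site 2) (c₀ t : V) (n : ℕ) (h : ℤ) (w : V) :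
    shearCoord φ t n h w = shearCoord φ c₀ n h w - shearCoord φ c₀ n h t := by
  simp only [shearCoord_apply]; ring

/-- Along offset in the x-frame: `runX w 0 − runX t 0 = σ·α_t(w)`. [folklore] -/
theorem runX_sub_runX_zero (φ : V → Site 2) (c₀ : V) (n : ℕ) (h σ : ℤ) (t w : V) :
    runX φ c₀ n h σ w 0 - runX φ c₀ n h σ t 0 = σ * relCoord φ t 0 w := by
  rw [runX_zero, runX_zero, relCoord_sub_origin φ c₀ t 0 w]; ring

/-- Transverse offset in the y′-frame: `runY w 1 − runY t 1 = σ·α_t(w)`. [folklore] -/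
theorem runY_sub_runY_one (φ : V → Site 2) (c₀ : V) (n : ℕ) (h σ : ℤ) (t w : V) :
    runY φ c₀ n h σ w 1 - runY φ c₀ n h σ t 1 = σ * relCoord φ t 0 w := by
  rw [runY_one, runY_one, relCoord_sub_origin φ c₀ t 0 w]; ring

/-- The floored coordinate: if `a ≤ σ·β′_t(w) ≤ b` then `⌊a/c⌋ ≤ runX w 1 − runX t 1 ≤ ⌊b/c⌋ + 1` (`c = n + |h| ≥ 1`). [folklore] -/
theorem runX_sub_runX_one_bounds {n : ℕ} (hn : 1 ≤ n) (φ : V → Site 2) (c₀ : V) (h σ : ℤ) (t w : V) {a b : ℤ}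
    (ha : a ≤ σ * shearCoord φ t n h w) (hb : σ * shearCoord φ t n h w ≤ b) :
    a / (shearUnit n h : ℤ) ≤ runX φ c₀ n h σ w 1 - runX φ c₀ n h σ t 1 ∧
      runX φ c₀ n h σ w 1 - runX φ c₀ n h σ t 1 ≤ b / (shearUnit n h : ℤ) + 1 := by
  have hc := shearUnit_pos hn h
  have e : σ * shearCoord φ c₀ n h w - σ * shearCoord φ c₀ n h t = σ * shearCoord φ t n h w := by
    rw [shearCoord_sub_origin φ c₀ t n h w]; ring
  rw [runX_one, runX_one]
  exact ⟨le_ediv_sub_ediv hc (by rw [e]; exact ha), ediv_sub_ediv_le_add_one hc (by rw [e]; exact hb)⟩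

/-- The same bounds in the y′-frame (along coordinate). [folklore] -/
theorem runY_sub_runY_zero_bounds {n : ℕ} (hn : 1 ≤ n) (φ : V → Site 2) (c₀ : V) (h σ : ℤ) (t w : V) {a b : ℤ}
    (ha : a ≤ σ * shearCoord φ t n h w) (hb : σ * shearCoord φ t n h w ≤ b) :
    a / (shearUnit n h : ℤ) ≤ runY φ c₀ n h σ w 0 - runY φ c₀ n h σ t 0 ∧
      runY φ c₀ n h σ w 0 - runY φ c₀ n h σ t 0 ≤ b / (shearUnit n h : ℤ) + 1 := by
  rw [runY_zero, runY_zero, ← runX_one φ c₀ n h σ w, ← runX_one φ c₀ n h σ t]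
  exact runX_sub_runX_one_bounds hn φ c₀ h σ t w ha hb

/-- Absolute floored transverse offset: `|σβ′_t(w)| ≤ L ⇒ |runX w 1 − runX t 1| ≤ ⌊L/c⌋ + 1`. [folklore] -/
theorem abs_runX_sub_runX_one_le {n : ℕ} (hn : 1 ≤ n) (φ : V → Site 2) (c₀ : V) (h : ℤ) {σ : ℤ} (hσ : σ = 1 ∨ σ = -1) (t w : V) {L : ℤ}
    (hL : |shearCoord φ t n h w| ≤ L) : |runX φ c₀ n h σ w 1 - runX φ c₀ n h σ t 1| ≤ L / (shearUnit n h : ℤ) + 1 := by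
  have hσ1 : |σ| = 1 := by rcases hσ with rfl | rfl <;> simp
  have e : σ * shearCoord φ c₀ n h w - σ * shearCoord φ c₀ n h t = σ * shearCoord φ t n h w := by
    rw [shearCoord_sub_origin φ c₀ t n h w]; ring
  rw [runX_one, runX_one]
  refine abs_ediv_sub_ediv_le (shearUnit_pos hn h) ?_
  rw [e, abs_mul, hσ1, one_mul]; exact hL

/-! ## §4 Window-unit run parameters -/

/-- **x-run parameters in window units** (frame `runX`): along-progress exactly `n`; no drift; pieces and window `⌊nℓ/c⌋ + 1`; isotropic siting slack `R′`;
link box `n × (⌊3nℓ/c⌋ + 1)` (`c = n + |h|`). [cite: MartineauTassion2017, §3.2 Lemma 3.5 (L(a,u), L(u,b)), §4.3 Lemma 4.2] -/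
def xPrmW (n ℓ : ℕ) (h : ℤ) (R' q N : ℕ) : ChainPara.RunPrm where
  sLo := n
  sHi := n
  d := 0
  Pp := n * ℓ / shearUnit n h + 1
  Pm := n * ℓ / shearUnit n h + 1
  Wp := n * ℓ / shearUnit n h + 1
  Wm := n * ℓ / shearUnit n h + 1
  ea := R'
  eb := R'
  La := n
  Lb := 3 * (n * ℓ) / shearUnit n h + 1
  q := q
  N := N

/-- **y′-run parameters in window units** (frame `runY`): along-progress in `[⌊(nℓ − c + 1)/c⌋, ⌊nℓ/c⌋ + 1]`; drift `v`; pieces `[0, n − v]` / `[−(n+v), 0]` and the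
matching window; isotropic siting slack `R′`; link box `(⌊3nℓ/c⌋ + 1) × n`. [cite: MartineauTassion2017, §3.2 Lemma 3.5 (L(v,b), L(−a,v)), §4.3 Lemma 4.2] -/
def yPrmW (n ℓ : ℕ) (h v : ℤ) (R' q N : ℕ) : ChainPara.RunPrm where
  sLo := (((n : ℤ) * ℓ - (shearUnit n h : ℕ) + 1) / (shearUnit n h : ℕ))
  sHi := (n : ℤ) * ℓ / (shearUnit n h : ℕ) + 1
  d := v
  Pp := (n - v).toNat
  Pm := (n + v).toNat
  Wp := (n - v).toNat
  Wm := (n + v).toNat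
  ea := R'
  eb := R'
  La := 3 * (n * ℓ) / shearUnit n h + 1
  Lb := n
  q := q
  N := N

/-- The x-run parameters in window units are admissible. [folklore] -/
theorem xPrmW_ok (n ℓ : ℕ) (h : ℤ) (R' q N : ℕ) : ChainPara.RunOK (xPrmW n ℓ h R' q N) where
  hs0 := by simp [xPrmW]
  hs := le_rfl
  hsL := by simp [xPrmW]
  hd := by simp only [xPrmW, abs_zero]; positivity
  hPm := le_rfl
  hPp := le_rfl

/-- The y′-run parameters in window units are admissible (`1 ≤ n`, `|v| ≤ n`, layer inequality `n + |h| ≤ nℓ + 1`). [folklore] -/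
theorem yPrmW_ok {n ℓ : ℕ} {h v : ℤ} (hn : 1 ≤ n) (hv : |v| ≤ n) (hlay : (n + h.natAbs : ℕ) ≤ (n : ℤ) * ℓ + 1) (R' q N : ℕ) :
    ChainPara.RunOK (yPrmW n ℓ h v R' q N) where
  hs0 := by
    simp only [yPrmW]
    have hc : (0 : ℤ) < (shearUnit n h : ℕ) := shearUnit_pos hn h
    exact Int.ediv_nonneg (by unfold shearUnit; push_cast at hlay ⊢; linarith) hc.le
  hs := by
    simp only [yPrmW]
    have hc : (0 : ℤ) < (shearUnit n h : ℕ) := shearUnit_pos hn h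
    have h1 : ((n : ℤ) * ℓ - (shearUnit n h : ℕ) + 1) / (shearUnit n h : ℕ) ≤ (n : ℤ) * ℓ / (shearUnit n h : ℕ) :=
      Int.ediv_le_ediv hc (by linarith)
    linarith
  hsL := by
    simp only [yPrmW]
    push_cast
    have hc : (0 : ℤ) < (shearUnit n h : ℕ) := shearUnit_pos hn h
    have h1 : (n : ℤ) * ℓ / (shearUnit n h : ℕ) ≤ 3 * ((n : ℤ) * ℓ) / (shearUnit n h : ℕ) :=
      Int.ediv_le_ediv hc (by linarith [show (0 : ℤ) ≤ (n : ℤ) * ℓ by positivity])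
    linarith
  hd := by simp only [yPrmW]; exact_mod_cast hv
  hPm := le_rfl
  hPp := le_rfl

/-- `eb = ea` for the x-run window parameters. [folklore] -/
theorem xPrmW_eb (n ℓ : ℕ) (h : ℤ) (R' q N : ℕ) : (xPrmW n ℓ h R' q N).eb = (xPrmW n ℓ h R' q N).ea := rfl

/-- `eb = ea` for the y′-run window parameters. [folklore] -/
theorem yPrmW_eb (n ℓ : ℕ) (h v : ℤ) (R' q N : ℕ) : (yPrmW n ℓ h v R' q N).eb = (yPrmW n ℓ h v R' q N).ea := rfl

/-! ## §5 Bridges from the (S-1) pieces to run coordinates -/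

/-- **Link box, x-frame**: a vertex of the link region `pgramPrism t n h (3ℓ) R` has along offset `≤ n = La` and floored transverse offset `≤ ⌊3nℓ/c⌋ + 1 = Lb` from
the seed centre `t`. [cite: MartineauTassion2017, §3.2 (R(a,b))] -/
theorem link_runX {n : ℕ} (hn : 1 ≤ n) (c₀ : V) (h : ℤ) {σ : ℤ} (hσ : σ = 1 ∨ σ = -1) {t w : V} {ℓ R : ℕ}
    (hw : w ∈ pgramPrism G φ t n h (3 * ℓ) R) (R' q N : ℕ) :
    |runX φ c₀ n h σ w 0 - runX φ c₀ n h σ t 0| ≤ (xPrmW n ℓ h R' q N).La ∧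
      |runX φ c₀ n h σ w 1 - runX φ c₀ n h σ t 1| ≤ (xPrmW n ℓ h R' q N).Lb := by
  have hσ1 : |σ| = 1 := by rcases hσ with rfl | rfl <;> simp
  obtain ⟨-, hα, hβ⟩ := (mem_pgramPrism G φ).1 hw
  refine ⟨?_, ?_⟩
  · rw [runX_sub_runX_zero, abs_mul, hσ1, one_mul]; simpa [xPrmW] using hα
  · have h1 := abs_runX_sub_runX_one_le hn φ c₀ h hσ t w hβ
    simp only [xPrmW]; push_cast
    have e : (3 : ℤ) * ((n : ℤ) * ℓ) = (n : ℤ) * ((3 * ℓ : ℕ) : ℤ) := by push_cast; ring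
    rw [e]; exact h1

/-- **Link box, y′-frame** (coordinates exchanged). [cite: MartineauTassion2017, §3.2 (R(a,b))] -/
theorem link_runY {n : ℕ} (hn : 1 ≤ n) (c₀ : V) (h : ℤ) {σ : ℤ} (hσ : σ = 1 ∨ σ = -1) {t w : V} {ℓ R : ℕ}
    (hw : w ∈ pgramPrism G φ t n h (3 * ℓ) R) (v : ℤ) (R' q N : ℕ) :
    |runY φ c₀ n h σ w 0 - runY φ c₀ n h σ t 0| ≤ (yPrmW n ℓ h v R' q N).La ∧
      |runY φ c₀ n h σ w 1 - runY φ c₀ n h σ t 1| ≤ (yPrmW n ℓ h v R' q N).Lb := by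
  obtain ⟨h0, h1⟩ := link_runX hn c₀ h hσ hw R' q N
  refine ⟨?_, ?_⟩
  · rw [runY_zero, runY_zero, ← runX_one φ c₀ n h σ w, ← runX_one φ c₀ n h σ t]; simpa [xPrmW, yPrmW] using h1
  · rw [runY_one, runY_one, ← runX_zero φ c₀ n h σ w, ← runX_zero φ c₀ n h σ t]; simpa [xPrmW, yPrmW] using h0

/-- **Landing of an x-stride**: a vertex of the side half `pgSideHalf t n h ℓ R σ τ` (the run's own sign `σ`) has along offset EXACTLY `n` and floored signed
transverse offset in the piece of sign `στ` of `xPrmW`. [cite: MartineauTassion2017, §3.2 Lemma 3.5 (L(a,u), L(u,b)), §4.3 Lemma 4.2] -/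
theorem landing_runX [G.LocallyFinite] {n : ℕ} (hn : 1 ≤ n) (c₀ : V) (h : ℤ) {σ τ : ℤ} (hσ : σ = 1 ∨ σ = -1) (hτ : τ = 1 ∨ τ = -1) {t w : V} {ℓ R : ℕ}
    (hw : w ∈ pgSideHalf G φ t n h ℓ R σ τ) (R' q N : ℕ) :
    runX φ c₀ n h σ w 0 - runX φ c₀ n h σ t 0 = n ∧
      (xPrmW n ℓ h R' q N).InPiece (σ * τ) (runX φ c₀ n h σ w 1 - runX φ c₀ n h σ t 1 - (xPrmW n ℓ h R' q N).d) := by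
  have hσσ : σ * σ = 1 := by rcases hσ with rfl | rfl <;> simp
  obtain ⟨hP, hα, hτβ⟩ := (mem_pgSideHalf G φ).1 hw
  obtain ⟨-, -, hβ⟩ := (mem_pgramPrism G φ).1 hP
  have hc := shearUnit_pos hn h
  refine ⟨by rw [runX_sub_runX_zero, hα, ← mul_assoc, hσσ, one_mul], ?_⟩
  rw [abs_le] at hβ
  have hd : (xPrmW n ℓ h R' q N).d = 0 := rfl
  have hPp : (xPrmW n ℓ h R' q N).Pp = n * ℓ / shearUnit n h + 1 := rfl
  have hPm : (xPrmW n ℓ h R' q N).Pm = n * ℓ / shearUnit n h + 1 := rfl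
  rw [ChainPara.RunPrm.InPiece, hd, sub_zero, hPp, hPm]
  push_cast
  -- `(−nℓ)/c ≥ −(nℓ/c) − 1`
  have hneg : -((n : ℤ) * ℓ / (shearUnit n h : ℕ)) - 1 ≤ -((n : ℤ) * ℓ) / (shearUnit n h : ℕ) := by
    have h2 := ediv_sub_ediv_le_add_one (x := 0) (y := -((n : ℤ) * ℓ)) (b := (n : ℤ) * ℓ) hc (by simp)
    rw [Int.zero_ediv, zero_sub] at h2
    linarith
  constructor
  · intro hστ
    -- `στ = 1`: `τ = σ`, `0 ≤ σβ′ ≤ nℓ`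
    have hτσ : τ = σ := by
      rcases hσ with rfl | rfl <;> rcases hτ with rfl | rfl <;> first | rfl | norm_num at hστ
    rw [hτσ] at hτβ
    have h1 : σ * shearCoord φ t n h w ≤ (n : ℤ) * ℓ := by
      rcases hσ with rfl | rfl <;> linarith [hβ.1, hβ.2]
    obtain ⟨ha, hb⟩ := runX_sub_runX_one_bounds hn φ c₀ h σ t w hτβ h1
    rw [Int.zero_ediv] at ha
    exact ⟨ha, hb⟩
  · intro hστ
    -- `στ = −1`: `τ = −σ`, `−nℓ ≤ σβ′ ≤ 0`
    have hτσ : τ = -σ := by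
      rcases hσ with rfl | rfl <;> rcases hτ with rfl | rfl <;> first | rfl | norm_num at hστ
    rw [hτσ] at hτβ
    have h1 : σ * shearCoord φ t n h w ≤ 0 := by rw [neg_mul] at hτβ; linarith
    have h0 : -((n : ℤ) * ℓ) ≤ σ * shearCoord φ t n h w := by
      rcases hσ with rfl | rfl <;> linarith [hβ.1, hβ.2]
    obtain ⟨ha, -⟩ := runX_sub_runX_one_bounds hn φ c₀ h σ t w h0 h1
    -- the upper bound `≤ 0` by monotonicity of the floor (the generic bound is loose by one here)
    have hb : runX φ c₀ n h σ w 1 - runX φ c₀ n h σ t 1 ≤ 0 := by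
      rw [runX_one, runX_one]
      have e : σ * shearCoord φ c₀ n h w - σ * shearCoord φ c₀ n h t = σ * shearCoord φ t n h w := by
        rw [shearCoord_sub_origin φ c₀ t n h w]; ring
      have hmono := Int.ediv_le_ediv hc (show σ * shearCoord φ c₀ n h w ≤ σ * shearCoord φ c₀ n h t by linarith)
      linarith
    exact ⟨by linarith, hb⟩

/-- **Landing of a y′-stride**: a vertex of the top piece `pgTopPiece t n h ℓ R σ τ v` (the run's own sign `σ`) has floored along offset in `[sLo, sHi]` of `yPrmW` and
transverse offset `σα − v` in the piece of sign `τ`. [cite: MartineauTassion2017, §3.2 Lemma 3.5 (L(v,b), L(−a,v)), §4.3 Lemma 4.2] -/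
theorem landing_runY [G.LocallyFinite] {n : ℕ} (hn : 1 ≤ n) (c₀ : V) (h : ℤ) {σ τ : ℤ} (hσ : σ = 1 ∨ σ = -1) (hτ : τ = 1 ∨ τ = -1) {t w : V} {ℓ R : ℕ} {v : ℤ}
    (hw : w ∈ pgTopPiece G φ t n h ℓ R σ τ v) (R' q N : ℕ) :
    ((yPrmW n ℓ h v R' q N).sLo ≤ runY φ c₀ n h σ w 0 - runY φ c₀ n h σ t 0 ∧
        runY φ c₀ n h σ w 0 - runY φ c₀ n h σ t 0 ≤ (yPrmW n ℓ h v R' q N).sHi) ∧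
      (yPrmW n ℓ h v R' q N).InPiece τ (runY φ c₀ n h σ w 1 - runY φ c₀ n h σ t 1 - (yPrmW n ℓ h v R' q N).d) := by
  have hσ1 : |σ| = 1 := by rcases hσ with rfl | rfl <;> simp
  obtain ⟨hP, hlay, hτα⟩ := (mem_pgTopPiece G φ).1 hw
  obtain ⟨-, hα, hβ⟩ := (mem_pgramPrism G φ).1 hP
  have hc := shearUnit_pos hn h
  rw [abs_le] at hβ hα
  refine ⟨?_, ?_⟩
  · -- along: `nℓ − c < σβ′ ≤ nℓ`
    have h1 : σ * shearCoord φ t n h w ≤ (n : ℤ) * ℓ := by rcases hσ with rfl | rfl <;> linarith [hβ.1, hβ.2]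
    have h0 : (n : ℤ) * ℓ - (shearUnit n h : ℕ) + 1 ≤ σ * shearCoord φ t n h w := by
      unfold shearUnit; linarith
    obtain ⟨ha, hb⟩ := runY_sub_runY_zero_bounds hn φ c₀ h σ t w h0 h1
    simp only [yPrmW]
    exact ⟨ha, hb⟩
  · -- transverse: `σα − v ∈ [0, n − v]` or `[−(n+v), 0]`
    rw [runY_sub_runY_one]
    simp only [yPrmW, ChainPara.RunPrm.InPiece]
    have hσα : -(n : ℤ) ≤ σ * relCoord φ t 0 w ∧ σ * relCoord φ t 0 w ≤ n := by
      rcases hσ with rfl | rfl <;> constructor <;> linarith [hα.1, hα.2]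
    constructor
    · intro hτ1; subst hτ1
      rw [one_mul] at hτα
      have hnv : ((n - v).toNat : ℤ) = n - v := Int.toNat_of_nonneg (by linarith [hσα.2])
      rw [hnv]; constructor <;> linarith [hσα.2]
    · intro hτ1; subst hτ1
      have hnv : ((n + v).toNat : ℤ) = n + v := Int.toNat_of_nonneg (by linarith [hσα.1])
      rw [hnv]; constructor <;> linarith [hσα.1]

end Skelφ

end Summit.CriticalPhenomena.PercolationContinuityZ3.Theorems.Transplant

end
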